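import Summits.QuantumFields.YangMills.Theorems.UnitScaleTiltProp7SectET3ObjectsPd
import Summits.QuantumFields.YangMills.Theorems.UnitScaleTiltProp7Growth142T3
import HarnessLib

/-!
# Route `UnitScaleTilt`, crux K1 child «MinimiserStabilityRegPr» (stmt-QuantumFields-19200), skeleton v10, stub `stub_existenceMinimalOrbit` (EX), route (α) — (S3) WITH THE
# LATTICE ABSTRACT: `UnitScaleTiltProp7CminOfP6T3` (p597048) re-stated for an ARBITRARY member-wise period vector `Pd i` and shift-compatible site chart `e i` (so the
# lattice of record `towerP F.L m (K−n)` ∕ `siteEquivTower` of OWNER RULING (J) and ★w5's `periodsT3` ∕ `siteEquiv` are both instances by `exact`) —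
# **C-min ⇐ P6@T³ (PROVED, `Prop7SectET3ObjectsPd.prop6_T3`) ∧ CHART-112 (displayed) ∧ GROWTH (★w4's `growth142_T3`, its (γ)-input displayed)**

Cell `ym3-torus`, width seat `ym-ust-19200-w2` (gen 2; OWNER RULING g25-№1 (S3), DE-CONFLICT 2026-08-28T01:54Z (2): «you type `Cmin_of_P6T3_chart_growth` with (i) by name or
LOCATED — and (ii) SUPPLIED BY ★w4»; 02:07:44Z: «bind file 3 against WHICHEVER lands first» — ★w4's (γ)-currency `growth142_T3`, p596198).  THEOREMS ONLY (0 `def`, 0 `sorry`).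
YM₃ on T³ is a ladder rung (R3), not the Clay problem; nothing here claims the stub, the crux, d = 4 or the mass gap.  `--supports stmt-QuantumFields-19200 --as helper`.

THE PRINT ([Balaban1985Variational] p. 296 and p. 299, verbatim): *«Equation (111) has a solution belonging to the space (115) with ε₄ = 2B₀C₁B₃ε₁, if 2B₀C₁B₃ε₁ ≤ a₄. This
solution determines a critical configuration U₁ by the transformation (112)»*; *«Thus the transformation (47) applied to A′₁ yields the configuration A′₁ − HD(A′₁) = 1/iη log U₁
satisfying all the conditions (19)–(21) with ε₂ = O(1)C₁B₃ε₁, where O(1) is an absolute constant depending on d and L only. … It is a critical configuration of the functional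
(5). To see that U_k is a minimum … A second order differential at A′ = 0 is given by the quadratic form above, and it is positive definite. Hence A′ = 0 is a minimum»*.

THE SHAPE (honest, adopted by the owner).  C-min — the hypothesis `hC` of ★w2 g0's `Prop7ExistRouteAlphaMin.existenceMinimalOrbit_of_Cmin_cov` (EX ⇐ C-min ∧ COV) — is NOT one
line from Prop. 6: between Prop. 6's solution `A₁ ∈ (115)_{U₀}` and C-min's exponent `X` with (20), (21) and «`e^{iX}U₀` minimises over the `ε₄`-ball» sit
 (i) **CHART-112** = (112) ∘ Props 3, 5 ∘ (123)–(140): every small solution `A₁` of (111) charts to a Hermitian-traceless `X` with `nMax19 U₀ X ≤ M·(‖A₁‖ + ‖H₁B‖)` ((19), ε₂ =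
     O(1)C₁B₃ε₁), (20) `AvgCondPrint`, (21) `IsLandauPrint`, and «critical» in the ONE E–L notion of record (`Prop7CritEL`'s def-free EL(V, W) at the axial representatives
     `W = (e^{iX}U₀)^u`) — DISPLAYED (`hChart`): the tree has the pieces only abstractly ∕ on other carriers (`B11Prop3Concrete.prop3_concrete` = (47) for [4]'s one-step
     remainder on the `ℤᵈ` carrier with `H` abstract; `B11Prop5Model`; `B11Prop7Assembly.ExistenceLeaves.crit112` as a displayed law), NOT against the route's k-fold (0.4)
     average + axial gauge (`AvgCondPrint`) — the V3-C∕D1c transfer, XL;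
 (ii) **GROWTH** = (141)–(142) on the nonlinear fibre — ★w4's `Prop7Growth142T3.growth142_T3` (p596198) CONSUMED BY `exact`; ITS input, route (γ)'s per-competitor relative-curvature
     Poincaré (ii′) ∧ θ-form first variation (iii′) at the axial representative `W` over `(6)(178ε₄)`, is DISPLAYED here member-uniformly (`hGrowth`: constants `C_P`, `θ < ½`,
     `C_L = c_S·ε₄·L^{−2(K−n)}` chosen BEFORE the member; antecedents = everything a supplier may use, incl. EL(V, W)).
The curved letters are OPAQUE PARAMETERS indexed by the member and the background — `𝒢f i U₀ = 𝔊(U₀) : |·|₍₋₃₎ → (115)_{U₀}`, `Wf i U₀ = (δ/δA′)V`, `H₁f i U₀ = H₁(U₀)`,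
`Bf i V U₀ = B(V, U₀)` on an abstract finite index `β i` — at an ABSTRACT member-wise chart `e i : Site (F.P K) 0 ≃ TSite d (Pd i)` intertwining the unit steps (`he`),
background lambda `fun b ↦ unitsField (toUField U₀) ⟨(e i)⁻¹ b.1, b.2⟩`, `lev ≡ K − n`, `η = L^{−(K−n)}`, with EXACTLY
the `B11Prop6Concrete.SectEDatum` bounds as displayed hypotheses at (14)-backgrounds of radius ≤ α: `norm_G` ([Balaban1985BackgroundPropagators] Thm 3.13 — N06(d = 3)), `prop4`
(Prop. 4 (97)–(98) — ★w4-20520 g2's lattice-free discharge binds here), `norm_H₁` (Thm 3.12 — N06(d = 3)), `bound20` (*«hence |B| < 2dLC₁ε₁»* ⇐ [Balaban1985RegularSpaces] (1.37)).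
Prop. 6 itself is NOT displayed: it is ★w2 g2's `Prop7SectET3ObjectsPd.prop6_T3` (p597247; kernel `B11Prop6Scheme` via `B11Prop6Concrete.exists_solution_concrete`).

WHAT IS PROVED.  ★★ **`Cmin_of_P6T3_chart_growth_pd`** — at every `L > 1` and `B₃ ≥ 3L`, for EVERY member-wise `(Pd, e, he)`: the displayed rows ⇒ the body of C-min at `(L, B₃)`
VERBATIM (`∃ B₀′ a₄′, …` with
`B₀′ = max{B₀, 5MB₀/2, ½}`, `a₄′ = min{¼, a₃/4, (16B₀C₄)⁻¹, α, 2r/3, (½ − θ)/(C_P(17088 + c_S))}`; inside: admissibility `L³B₃ε₁ ≤ α`, Prop. 6 at the (115)-radius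
`2B₀L³B₃ε₁` with `C₁ = L³` and the datum `H₁B` (‖H₁B‖ ≤ B₀·6L·L³ε₁ ≤ 2B₀L³B₃ε₁), CHART-112, the axial representative from (20), `growth142_T3`).
EX then follows BY NAME at every `B₃ > 4` with `3L ≤ B₃`: `Prop7ExistRouteAlphaMin.existenceMinimalOrbit_of_Cmin_cov hL hB₃ (Cmin_of_P6T3_chart_growth_pd hL h3L … hGrowth) hCOV`
= the registered text of `stub_existenceMinimalOrbit` at `(L, B₃)` from {N06(d = 3) ×2, Prop. 4, (1.37), CHART-112, (γ)-growth, COV} — no corollary is restated here.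

HONEST SCOPE.  Bookkeeping: the analytic content is in the displayed rows (N06(d = 3) ×2, Prop. 4, (1.37), CHART-112, (γ)-growth) and in the PROVED Prop. 6 kernel; nothing of
[Balaban1985Variational] Sects. C–E beyond Prop. 6's contraction is asserted; count-neutral helper toward stmt-QuantumFields-19200, not a proof of the stub.

References: T. Bałaban, CMP 102 (1985) 277–309 [Balaban1985Variational] ((14) p.280, (19)–(21) p.281, (47) p.285, Prop. 3 p.289, (103) p.293, (111)–(112) p.294, Props 5–6
pp.294–296, (115)–(117) p.295, (123)–(142) pp.296–299, Prop. 7 p.299); CMP 99 (1985) 389–434 [Balaban1985BackgroundPropagators] (Thms 3.12–3.13); CMP 99 (1985) 75–102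
[Balaban1985RegularSpaces] ((1.37) p.82, Thm 2 p.83, Prop. 7 (1.144) p.100).
-/

set_option autoImplicit false

noncomputable section

open scoped BigOperators Matrix.Norms.L2Operator Matrix

namespace Summit.QuantumFields.YangMills.Theorems.Prop7CminOfP6T3Pd

open Literature.MathematicalPhysics.QuantumFieldTheory.Balaban1983to89
open Literature.MathematicalPhysics.QuantumFieldTheory.Balaban1983to89.T3ContinuumYM3Torus
open Literature.MathematicalPhysics.QuantumFieldTheory.Balaban1983to89.T3UnitLawDensityEML (ℰp)
open Literature.MathematicalPhysics.QuantumFieldTheory.Balaban1983to89.T3ConstrainedMinimiser (fibre)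
open Literature.MathematicalPhysics.QuantumFieldTheory.Balaban1983to89.T3PrintedRegularMinimiser (RegPr regFibrePr)
open Literature.MathematicalPhysics.QuantumFieldTheory.Balaban1983to89.T3PrintedRegularOrbits (descTransf)
open Literature.MathematicalPhysics.QuantumFieldTheory.Balaban1983to89.T3Thm1Carrier
open Literature.MathematicalPhysics.QuantumFieldTheory.Balaban1983to89.T3SectALandauChart (In19 emb15 CloseAvg)
open BlockAveragingEMLLinearisedBackground (pertVar)
open B9SectCLatticeCarrier (Bond)
open B11Eq115Space (NegSize Space115)
open B11Eq111FrakG (nabla115)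
open B11Eq98CurrentSlot (Jcur)
open B13Contraction113 (QuadAnalytic)
open Summit.QuantumFields.YangMills.Theorems.Prop7TPrint (nMax19 expHermField expHermField_apply coe_expHerm)
open Summit.QuantumFields.YangMills.Theorems.Prop7SPrint (AvgCondPrint IsLandauPrint RestrictedPrint IsAxialPrint)
open B4Sect5Torus (TSite)
open B10Eq27TorusAxialLog (unitsField toUField)
open Summit.QuantumFields.YangMills.Theorems.Prop7SectET3ObjectsPd (prop6_T3)
open Summit.QuantumFields.YangMills.Theorems.Prop7Growth142T3 (growth142_T3)

variable {L : ℕ}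

/-- ★★ **C-min FROM PROPOSITION 6 AT THE T³ OBJECTS (PROVED), CHART-112 (DISPLAYED) AND ★w4's GROWTH (its (γ)-input DISPLAYED), LATTICE ABSTRACT**, the curved letters opaque
with their `SectEDatum` bounds.  Charts: any member-wise periods `Pd i` and shift-compatible `e i` (`he`).  Letters (parameters, per member `i = (F, n, K)` of `Idx L` and
background `U₀`, read as `fun b ↦ unitsField (toUField U₀) ⟨(e i)⁻¹ b.1, b.2⟩`): `𝒢f i U₀ = 𝔊(U₀)`, `Wf i U₀ = (δ/δA′)V`,
`H₁f i U₀ = H₁(U₀)` on an abstract finite index `β i`, `Bf i V U₀ = B(V, U₀)`.  Displayed rows: `norm_G` (‖𝔊f‖ ≤ B₀‖f‖, [Balaban1985BackgroundPropagators] Thm 3.13 — N06),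
`prop4` (Prop. 4), `norm_H₁` (Thm 3.12 — N06), all at backgrounds `U₀ ∈ 𝔘_k(e)`, `e ≤ α`; `bound20` (|B| < 2·3L·L³ε₁ under (7)/(14)); `hChart` = CHART-112 ((112), Props 3, 5,
(123)–(140): a small solution of (111) charts to `X` Hermitian-traceless with `nMax19 ≤ M(‖A₁‖ + ‖H₁B‖)`, (20), (21), E–L-critical at its axial representatives); `hGrowth` = the
(γ)-input of `Prop7Growth142T3.growth142_T3` (per-competitor (ii′) ∧ (iii′) over `(6)(178ε₄)` at the axial representative `W`, constants `C_P`, `θ < ½`, `C_L = c_S·ε₄·L^{−2(K−n)}`).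
Conclusion: the body of C-min (`Prop7ExistRouteAlphaMin.existenceMinimalOrbit_of_Cmin_cov`'s `hC`) at `(L, B₃)` VERBATIM.
[cite: Balaban1985Variational, Prop. 6 p.295, (112) p.294, p.296, (141)-(142) p.299, (19)-(21) p.281, (14) p.280, (103) p.293] -/
theorem Cmin_of_P6T3_chart_growth_pd (hL : 1 < L) {B₃ : ℝ} (hB₃ : 3 * (L : ℝ) ≤ B₃)
    [hFL : ∀ F : T3Family, Fact (0 < (F.L : ℝ))] [hFη : ∀ (F : T3Family) (k : ℕ), Fact (0 < ((F.L : ℝ)⁻¹) ^ k)]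
    -- the lattice periods and the site charts, ABSTRACT (periodsT3 ∕ towerP are instances)
    (Pd : ∀ i : Idx L, Fin (i.1.1.P i.1.2.2).d → ℕ) (e : ∀ i : Idx L, Site (i.1.1.P i.1.2.2) 0 ≃ TSite (i.1.1.P i.1.2.2).d (Pd i))
    (he : ∀ (i : Idx L) (x : Site (i.1.1.P i.1.2.2) 0) (μ : Fin (i.1.1.P i.1.2.2).d), e i (x.shift μ) = B9Eq33CovDerivVector.shiftEquiv μ (e i x))
    {B₀ C₄ a₃ α r M CP θ cS : ℝ} (hB₀ : 0 < B₀) (hC₄ : 0 < C₄) (ha₃ : 0 < a₃) (hα : 0 < α) (hr : 0 < r) (hM : 0 < M) (hCP : 0 < CP) (hθ : θ < 1 / 2)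
    (hcS : 0 ≤ cS)
    -- the curved letters, OPAQUE
    (𝒢f : ∀ (i : Idx L) (U₀ : GaugeField (i.1.1.P i.1.2.2) 0 (Matrix.specialUnitaryGroup (Fin 2) ℂ)),
      NegSize (i.1.1.L : ℝ) (((i.1.1.L : ℝ)⁻¹) ^ (i.1.2.2 - i.1.2.1)) (fun _ : Bond (i.1.1.P i.1.2.2).d (Pd i) => i.1.2.2 - i.1.2.1) 3
          (Matrix (Fin 2) (Fin 2) ℂ) →L[ℂ]
        Space115 (i.1.1.L : ℝ) (((i.1.1.L : ℝ)⁻¹) ^ (i.1.2.2 - i.1.2.1)) (fun _ : Bond (i.1.1.P i.1.2.2).d (Pd i) => i.1.2.2 - i.1.2.1)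
          (fun _ : Bond (i.1.1.P i.1.2.2).d (Pd i) × Fin (i.1.1.P i.1.2.2).d => i.1.2.2 - i.1.2.1) (nabla115 (((i.1.1.L : ℝ)⁻¹) ^ (i.1.2.2 - i.1.2.1)) (fun b : Bond (i.1.1.P i.1.2.2).d (Pd i) => unitsField (toUField U₀) ⟨(e i).symm b.1, b.2⟩)))
    (Wf : ∀ (i : Idx L) (U₀ : GaugeField (i.1.1.P i.1.2.2) 0 (Matrix.specialUnitaryGroup (Fin 2) ℂ)),
      Space115 (i.1.1.L : ℝ) (((i.1.1.L : ℝ)⁻¹) ^ (i.1.2.2 - i.1.2.1)) (fun _ : Bond (i.1.1.P i.1.2.2).d (Pd i) => i.1.2.2 - i.1.2.1)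
          (fun _ : Bond (i.1.1.P i.1.2.2).d (Pd i) × Fin (i.1.1.P i.1.2.2).d => i.1.2.2 - i.1.2.1) (nabla115 (((i.1.1.L : ℝ)⁻¹) ^ (i.1.2.2 - i.1.2.1)) (fun b : Bond (i.1.1.P i.1.2.2).d (Pd i) => unitsField (toUField U₀) ⟨(e i).symm b.1, b.2⟩)) →
        NegSize (i.1.1.L : ℝ) (((i.1.1.L : ℝ)⁻¹) ^ (i.1.2.2 - i.1.2.1)) (fun _ : Bond (i.1.1.P i.1.2.2).d (Pd i) => i.1.2.2 - i.1.2.1) 3 (Matrix (Fin 2) (Fin 2) ℂ))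
    (β : Idx L → Type) [∀ i, Fintype (β i)]
    (H₁f : ∀ (i : Idx L) (U₀ : GaugeField (i.1.1.P i.1.2.2) 0 (Matrix.specialUnitaryGroup (Fin 2) ℂ)),
      (β i → Matrix (Fin 2) (Fin 2) ℂ) →L[ℂ]
        Space115 (i.1.1.L : ℝ) (((i.1.1.L : ℝ)⁻¹) ^ (i.1.2.2 - i.1.2.1)) (fun _ : Bond (i.1.1.P i.1.2.2).d (Pd i) => i.1.2.2 - i.1.2.1)
          (fun _ : Bond (i.1.1.P i.1.2.2).d (Pd i) × Fin (i.1.1.P i.1.2.2).d => i.1.2.2 - i.1.2.1) (nabla115 (((i.1.1.L : ℝ)⁻¹) ^ (i.1.2.2 - i.1.2.1)) (fun b : Bond (i.1.1.P i.1.2.2).d (Pd i) => unitsField (toUField U₀) ⟨(e i).symm b.1, b.2⟩)))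
    (Bf : ∀ (i : Idx L), GaugeField (i.1.1.P i.1.2.1) 0 (Matrix.specialUnitaryGroup (Fin 2) ℂ) → GaugeField (i.1.1.P i.1.2.2) 0 (Matrix.specialUnitaryGroup (Fin 2) ℂ) →
      β i → Matrix (Fin 2) (Fin 2) ℂ)
    -- their displayed bounds (the `SectEDatum` fields at admissible backgrounds)
    (norm_G : ∀ (i : Idx L) (e : ℝ) (U₀ : GaugeField (i.1.1.P i.1.2.2) 0 (Matrix.specialUnitaryGroup (Fin 2) ℂ)),
      RegPr i.1.1 i.1.2.1 i.1.2.2 e U₀ → e ≤ α → ∀ f, ‖𝒢f i U₀ f‖ ≤ B₀ * ‖f‖)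
    (prop4 : ∀ (i : Idx L) (e : ℝ) (U₀ : GaugeField (i.1.1.P i.1.2.2) 0 (Matrix.specialUnitaryGroup (Fin 2) ℂ)),
      RegPr i.1.1 i.1.2.1 i.1.2.2 e U₀ → e ≤ α → QuadAnalytic (Wf i U₀) C₄ a₃)
    (norm_H₁ : ∀ (i : Idx L) (e : ℝ) (U₀ : GaugeField (i.1.1.P i.1.2.2) 0 (Matrix.specialUnitaryGroup (Fin 2) ℂ)),
      RegPr i.1.1 i.1.2.1 i.1.2.2 e U₀ → e ≤ α → ∀ b, ‖H₁f i U₀ b‖ ≤ B₀ * ‖b‖)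
    (bound20 : ∀ (i : Idx L) (ε₁ : ℝ) (V : GaugeField (i.1.1.P i.1.2.1) 0 (Matrix.specialUnitaryGroup (Fin 2) ℂ))
      (U₀ : GaugeField (i.1.1.P i.1.2.2) 0 (Matrix.specialUnitaryGroup (Fin 2) ℂ)), 0 < ε₁ → PlaqSmall ε₁ V →
      RegPr i.1.1 i.1.2.1 i.1.2.2 ((L : ℝ) ^ 3 * B₃ * ε₁) U₀ → CloseAvg i.1.1 i.1.2.1 i.1.2.2 i.2.2.le ((L : ℝ) ^ 3 * ε₁) V U₀ →
      ‖Bf i V U₀‖ < 2 * ((3 : ℝ) * i.1.1.L) * ((L : ℝ) ^ 3 * ε₁))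
    -- (i) CHART-112, displayed
    (hChart : ∀ (i : Idx L) (ε₁ : ℝ) (V : GaugeField (i.1.1.P i.1.2.1) 0 (Matrix.specialUnitaryGroup (Fin 2) ℂ))
      (U₀ : GaugeField (i.1.1.P i.1.2.2) 0 (Matrix.specialUnitaryGroup (Fin 2) ℂ)), 0 < ε₁ → PlaqSmall ε₁ V →
      RegPr i.1.1 i.1.2.1 i.1.2.2 ((L : ℝ) ^ 3 * B₃ * ε₁) U₀ → CloseAvg i.1.1 i.1.2.1 i.1.2.2 i.2.2.le ((L : ℝ) ^ 3 * ε₁) V U₀ → (L : ℝ) ^ 3 * B₃ * ε₁ ≤ α →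
      ∀ A₁ : Space115 (i.1.1.L : ℝ) (((i.1.1.L : ℝ)⁻¹) ^ (i.1.2.2 - i.1.2.1)) (fun _ : Bond (i.1.1.P i.1.2.2).d (Pd i) => i.1.2.2 - i.1.2.1)
          (fun _ : Bond (i.1.1.P i.1.2.2).d (Pd i) × Fin (i.1.1.P i.1.2.2).d => i.1.2.2 - i.1.2.1) (nabla115 (((i.1.1.L : ℝ)⁻¹) ^ (i.1.2.2 - i.1.2.1)) (fun b : Bond (i.1.1.P i.1.2.2).d (Pd i) => unitsField (toUField U₀) ⟨(e i).symm b.1, b.2⟩)),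
        ‖A₁‖ < r → A₁ + 𝒢f i U₀ (Jcur (fun b : Bond (i.1.1.P i.1.2.2).d (Pd i) => unitsField (toUField U₀) ⟨(e i).symm b.1, b.2⟩)) + 𝒢f i U₀ (Wf i U₀ (A₁ + H₁f i U₀ (Bf i V U₀))) = 0 →
        ∃ X : PBond (i.1.1.P i.1.2.2) 0 → Matrix (Fin 2) (Fin 2) ℂ,
          (∀ b : PBond (i.1.1.P i.1.2.2) 0, (X b).IsHermitian ∧ Matrix.trace (X b) = 0) ∧
          nMax19 i.1.1 i.1.2.1 i.1.2.2 U₀ X ≤ M * (‖A₁‖ + ‖H₁f i U₀ (Bf i V U₀)‖) ∧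
          AvgCondPrint i.1.1 i.1.2.1 i.1.2.2 i.2.2.le V U₀ X ∧ IsLandauPrint i.1.1 i.1.2.1 i.1.2.2 U₀ X ∧
          (∀ u : GaugeTransf (i.1.1.P i.1.2.2) 0 (Matrix.specialUnitaryGroup (Fin 2) ℂ), RestrictedPrint i.1.1 i.1.2.1 i.1.2.2 U₀ u →
            GaugeField.gaugeAct u (emb15 U₀ (expHermField X)) ∈ fibre i.1.1 ℰp i.1.2.1 i.1.2.2 i.2.2.le V →
            ∀ γ : ℝ → GaugeField (i.1.1.P i.1.2.2) 0 (Matrix.specialUnitaryGroup (Fin 2) ℂ), γ 0 = GaugeField.gaugeAct u (emb15 U₀ (expHermField X)) →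
              (∀ t, γ t ∈ fibre i.1.1 ℰp i.1.2.1 i.1.2.2 i.2.2.le V) →
              (∀ b, DifferentiableAt ℝ (fun t => ((γ t b : Matrix.specialUnitaryGroup (Fin 2) ℂ) : Matrix (Fin 2) (Fin 2) ℂ)) 0) →
                deriv (fun t => wilsonAction4 (γ t)) 0 = 0))
    -- (ii) the (γ)-input of ★w4's `growth142_T3`, displayed member-uniformly
    (hGrowth : ∀ (i : Idx L) (ε₁ ε₄ : ℝ) (V : GaugeField (i.1.1.P i.1.2.1) 0 (Matrix.specialUnitaryGroup (Fin 2) ℂ))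
      (U₀ : GaugeField (i.1.1.P i.1.2.2) 0 (Matrix.specialUnitaryGroup (Fin 2) ℂ)) (X : PBond (i.1.1.P i.1.2.2) 0 → Matrix (Fin 2) (Fin 2) ℂ)
      (u : GaugeTransf (i.1.1.P i.1.2.2) 0 (Matrix.specialUnitaryGroup (Fin 2) ℂ)) (W : GaugeField (i.1.1.P i.1.2.2) 0 (Matrix.specialUnitaryGroup (Fin 2) ℂ)),
      0 < ε₁ → ε₄ ≤ 1 / 4 → (L : ℝ) ^ 3 * B₃ * ε₁ ≤ ε₄ → PlaqSmall ε₁ V → RegPr i.1.1 i.1.2.1 i.1.2.2 ((L : ℝ) ^ 3 * B₃ * ε₁) U₀ →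
      CloseAvg i.1.1 i.1.2.1 i.1.2.2 i.2.2.le ((L : ℝ) ^ 3 * ε₁) V U₀ → (∀ b : PBond (i.1.1.P i.1.2.2) 0, (X b).IsHermitian ∧ Matrix.trace (X b) = 0) →
      nMax19 i.1.1 i.1.2.1 i.1.2.2 U₀ X < ε₄ → AvgCondPrint i.1.1 i.1.2.1 i.1.2.2 i.2.2.le V U₀ X → IsLandauPrint i.1.1 i.1.2.1 i.1.2.2 U₀ X →
      RestrictedPrint i.1.1 i.1.2.1 i.1.2.2 U₀ u → W = GaugeField.gaugeAct u (emb15 U₀ (expHermField X)) → IsAxialPrint i.1.1 i.1.2.1 i.1.2.2 U₀ W →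
      W ∈ fibre i.1.1 ℰp i.1.2.1 i.1.2.2 i.2.2.le V →
      (∀ γ : ℝ → GaugeField (i.1.1.P i.1.2.2) 0 (Matrix.specialUnitaryGroup (Fin 2) ℂ), γ 0 = W → (∀ t, γ t ∈ fibre i.1.1 ℰp i.1.2.1 i.1.2.2 i.2.2.le V) →
        (∀ b, DifferentiableAt ℝ (fun t => ((γ t b : Matrix.specialUnitaryGroup (Fin 2) ℂ) : Matrix (Fin 2) (Fin 2) ℂ)) 0) →
          deriv (fun t => wilsonAction4 (γ t)) 0 = 0) →
      ∀ W' : GaugeField (i.1.1.P i.1.2.2) 0 (Matrix.specialUnitaryGroup (Fin 2) ℂ), W' ∈ regFibrePr i.1.1 i.1.2.1 i.1.2.2 i.2.2.le (178 * ε₄) V →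
        ∃ g : GaugeTransf (i.1.1.P i.1.2.2) 0 (Matrix.specialUnitaryGroup (Fin 2) ℂ), descTransf i.1.1 i.1.2.1 i.1.2.2 i.2.2.le g = (fun _ => 1) ∧
          (∑ b : PBond (i.1.1.P i.1.2.2) 0, ‖pertVar W (GaugeField.gaugeAct g W') b‖ ^ 2 ≤
            CP * ((i.1.1.L : ℝ) ^ (i.1.2.2 - i.1.2.1)) ^ 2 * ∑ p : Plaq (i.1.1.P i.1.2.2) 0,
              ‖((GaugeField.plaqHol (GaugeField.gaugeAct g W') p : Matrix.specialUnitaryGroup (Fin 2) ℂ) : Matrix (Fin 2) (Fin 2) ℂ)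
                  * star ((GaugeField.plaqHol W p : Matrix.specialUnitaryGroup (Fin 2) ℂ) : Matrix (Fin 2) (Fin 2) ℂ) - 1‖ ^ 2) ∧
          (-(θ * ∑ p : Plaq (i.1.1.P i.1.2.2) 0,
              ‖((GaugeField.plaqHol (GaugeField.gaugeAct g W') p : Matrix.specialUnitaryGroup (Fin 2) ℂ) : Matrix (Fin 2) (Fin 2) ℂ)
                  * star ((GaugeField.plaqHol W p : Matrix.specialUnitaryGroup (Fin 2) ℂ) : Matrix (Fin 2) (Fin 2) ℂ) - 1‖ ^ 2) -
              (cS * ε₄ * (((i.1.1.L : ℝ) ^ (i.1.2.2 - i.1.2.1)) ^ 2)⁻¹) * ∑ b : PBond (i.1.1.P i.1.2.2) 0, ‖pertVar W (GaugeField.gaugeAct g W') b‖ ^ 2 ≤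
            ∑ p : Plaq (i.1.1.P i.1.2.2) 0, (1 / 2) * ((((((GaugeField.plaqHol W p : Matrix.specialUnitaryGroup (Fin 2) ℂ) : Matrix (Fin 2) (Fin 2) ℂ)) - 1)ᴴ
              * (((((GaugeField.gaugeAct g W' ⟨p.src, p.μ⟩ : Matrix.specialUnitaryGroup (Fin 2) ℂ) : Matrix (Fin 2) (Fin 2) ℂ) * star (W ⟨p.src, p.μ⟩ : Matrix (Fin 2) (Fin 2) ℂ) - 1)
                  + (W ⟨p.src, p.μ⟩ : Matrix (Fin 2) (Fin 2) ℂ)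
                      * (((GaugeField.gaugeAct g W' ⟨p.src.shift p.μ, p.ν⟩ : Matrix.specialUnitaryGroup (Fin 2) ℂ) : Matrix (Fin 2) (Fin 2) ℂ) *
                          star (W ⟨p.src.shift p.μ, p.ν⟩ : Matrix (Fin 2) (Fin 2) ℂ) - 1)
                      * star (W ⟨p.src, p.μ⟩ : Matrix (Fin 2) (Fin 2) ℂ)
                  - ((W ⟨p.src, p.μ⟩ * W ⟨p.src.shift p.μ, p.ν⟩ * (W ⟨p.src.shift p.ν, p.μ⟩)⁻¹ : Matrix.specialUnitaryGroup (Fin 2) ℂ) :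
                        Matrix (Fin 2) (Fin 2) ℂ)
                      * (((GaugeField.gaugeAct g W' ⟨p.src.shift p.ν, p.μ⟩ : Matrix.specialUnitaryGroup (Fin 2) ℂ) : Matrix (Fin 2) (Fin 2) ℂ) *
                          star (W ⟨p.src.shift p.ν, p.μ⟩ : Matrix (Fin 2) (Fin 2) ℂ) - 1)
                      * star ((W ⟨p.src, p.μ⟩ * W ⟨p.src.shift p.μ, p.ν⟩ * (W ⟨p.src.shift p.ν, p.μ⟩)⁻¹ : Matrix.specialUnitaryGroup (Fin 2) ℂ) :
                        Matrix (Fin 2) (Fin 2) ℂ)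
                  - ((GaugeField.plaqHol W p : Matrix.specialUnitaryGroup (Fin 2) ℂ) : Matrix (Fin 2) (Fin 2) ℂ)
                      * (((GaugeField.gaugeAct g W' ⟨p.src, p.ν⟩ : Matrix.specialUnitaryGroup (Fin 2) ℂ) : Matrix (Fin 2) (Fin 2) ℂ) * star (W ⟨p.src, p.ν⟩ : Matrix (Fin 2) (Fin 2) ℂ) - 1)
                      * star ((GaugeField.plaqHol W p : Matrix.specialUnitaryGroup (Fin 2) ℂ) : Matrix (Fin 2) (Fin 2) ℂ))
                * ((GaugeField.plaqHol W p : Matrix.specialUnitaryGroup (Fin 2) ℂ) : Matrix (Fin 2) (Fin 2) ℂ))).trace).re)) :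
    ∃ B₀' a₄' : ℝ, 0 < B₀' ∧ 0 < a₄' ∧ ∀ (i : Idx L) (ε₁ ε₄ : ℝ), 0 < ε₁ → ε₄ ≤ a₄' → 2 * B₀' * (L : ℝ) ^ 3 * B₃ * ε₁ ≤ ε₄ →
        ∀ (V : GaugeField (i.1.1.P i.1.2.1) 0 (Matrix.specialUnitaryGroup (Fin 2) ℂ)) (U₀ : GaugeField (i.1.1.P i.1.2.2) 0 (Matrix.specialUnitaryGroup (Fin 2) ℂ)),
          PlaqSmall ε₁ V → RegPr i.1.1 i.1.2.1 i.1.2.2 ((L : ℝ) ^ 3 * B₃ * ε₁) U₀ → CloseAvg i.1.1 i.1.2.1 i.1.2.2 i.2.2.le ((L : ℝ) ^ 3 * ε₁) V U₀ →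
          ∃ X : PBond (i.1.1.P i.1.2.2) 0 → Matrix (Fin 2) (Fin 2) ℂ,
            nMax19 i.1.1 i.1.2.1 i.1.2.2 U₀ X < 3 * B₀' * (L : ℝ) ^ 3 * B₃ * ε₁ ∧ (∀ b : PBond (i.1.1.P i.1.2.2) 0, (X b).IsHermitian ∧ Matrix.trace (X b) = 0) ∧
            AvgCondPrint i.1.1 i.1.2.1 i.1.2.2 i.2.2.le V U₀ X ∧ IsLandauPrint i.1.1 i.1.2.1 i.1.2.2 U₀ X ∧
            ∀ X' : PBond (i.1.1.P i.1.2.2) 0 → Matrix (Fin 2) (Fin 2) ℂ, nMax19 i.1.1 i.1.2.1 i.1.2.2 U₀ X' < ε₄ → (∀ b : PBond (i.1.1.P i.1.2.2) 0, (X' b).IsHermitian ∧ Matrix.trace (X' b) = 0) →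
              AvgCondPrint i.1.1 i.1.2.1 i.1.2.2 i.2.2.le V U₀ X' → IsLandauPrint i.1.1 i.1.2.1 i.1.2.2 U₀ X' →
                wilsonAction4 (emb15 U₀ (expHermField X)) ≤ wilsonAction4 (emb15 U₀ (expHermField X')) := by
  have hL1 : (1 : ℝ) ≤ (L : ℝ) := by exact_mod_cast hL.le
  have hL0 : (0 : ℝ) < (L : ℝ) := by positivity
  have hL3 : (0 : ℝ) < (L : ℝ) ^ 3 := by positivity
  have hB₃0 : 0 < B₃ := lt_of_lt_of_le (by positivity) hB₃
  have hθ' : 0 < 1 / 2 - θ := by linarith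
  -- the constants of C-min
  set B₀' : ℝ := max (max B₀ (5 * M * B₀ / 2)) (1 / 2) with hB₀'_def
  have hB₀le : B₀ ≤ B₀' := (le_max_left _ _).trans (le_max_left _ _)
  have h5M : 5 * M * B₀ / 2 ≤ B₀' := (le_max_right _ _).trans (le_max_left _ _)
  have hhalf : 1 / 2 ≤ B₀' := le_max_right _ _
  have hB₀'0 : 0 < B₀' := lt_of_lt_of_le (by norm_num) hhalf
  set a₄' : ℝ := min (min (min (min (min (1 / 4) (a₃ / 4)) (1 / (16 * B₀ * C₄))) α) (2 * r / 3)) ((1 / 2 - θ) / (CP * (17088 + cS)))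
    with ha₄'_def
  have ha₄'0 : 0 < a₄' :=
    lt_min (lt_min (lt_min (lt_min (lt_min (by norm_num) (by positivity)) (by positivity)) hα) (by positivity)) (by positivity)
  have ha1 : a₄' ≤ 1 / 4 := (min_le_left _ _).trans ((min_le_left _ _).trans ((min_le_left _ _).trans ((min_le_left _ _).trans (min_le_left _ _))))
  have ha2 : a₄' ≤ a₃ / 4 := (min_le_left _ _).trans ((min_le_left _ _).trans ((min_le_left _ _).trans ((min_le_left _ _).trans (min_le_right _ _))))
  have ha3 : a₄' ≤ 1 / (16 * B₀ * C₄) := (min_le_left _ _).trans ((min_le_left _ _).trans ((min_le_left _ _).trans (min_le_right _ _)))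
  have ha4 : a₄' ≤ α := (min_le_left _ _).trans ((min_le_left _ _).trans (min_le_right _ _))
  have ha5 : a₄' ≤ 2 * r / 3 := (min_le_left _ _).trans (min_le_right _ _)
  have ha6 : a₄' ≤ (1 / 2 - θ) / (CP * (17088 + cS)) := min_le_right _ _
  refine ⟨B₀', a₄', hB₀'0, ha₄'0, ?_⟩
  intro i ε₁ ε₄ hε₁ hε₄a h2B V U₀ hV hreg hclose
  have hFL' : (i.1.1.L : ℝ) = (L : ℝ) := by exact_mod_cast i.2.1
  have hP0 : 0 ≤ (L : ℝ) ^ 3 * B₃ * ε₁ := by positivity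
  -- the smallness facts carried by `2B₀′L³B₃ε₁ ≤ ε₄ ≤ a₄′`
  have hε₄4 : ε₄ ≤ 1 / 4 := hε₄a.trans ha1
  have hlo : (L : ℝ) ^ 3 * B₃ * ε₁ ≤ ε₄ := by
    have h' : (1 : ℝ) * ((L : ℝ) ^ 3 * B₃ * ε₁) ≤ (2 * B₀') * ((L : ℝ) ^ 3 * B₃ * ε₁) := mul_le_mul_of_nonneg_right (by linarith) hP0
    linarith
  have h2B₀ : 2 * B₀ * (L : ℝ) ^ 3 * B₃ * ε₁ ≤ ε₄ := by
    have h' : (2 * B₀) * ((L : ℝ) ^ 3 * B₃ * ε₁) ≤ (2 * B₀') * ((L : ℝ) ^ 3 * B₃ * ε₁) := mul_le_mul_of_nonneg_right (by linarith) hP0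
    linarith
  have hαe : (L : ℝ) ^ 3 * B₃ * ε₁ ≤ α := hlo.trans (hε₄a.trans ha4)
  have h2 : 4 * (2 * B₀ * (L : ℝ) ^ 3 * B₃ * ε₁) ≤ a₃ := by linarith [hε₄a.trans ha2]
  have h3 : 16 * B₀ * C₄ * (2 * B₀ * (L : ℝ) ^ 3 * B₃ * ε₁) ≤ 1 := by
    have hBC : 0 < 16 * B₀ * C₄ := by positivity
    have h' : 2 * B₀ * (L : ℝ) ^ 3 * B₃ * ε₁ ≤ 1 / (16 * B₀ * C₄) := h2B₀.trans (hε₄a.trans ha3)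
    calc 16 * B₀ * C₄ * (2 * B₀ * (L : ℝ) ^ 3 * B₃ * ε₁) ≤ 16 * B₀ * C₄ * (1 / (16 * B₀ * C₄)) := mul_le_mul_of_nonneg_left h' hBC.le
      _ = 1 := by field_simp
  have hdLB₃ : (3 : ℝ) * i.1.1.L ≤ B₃ := by rw [hFL']; exact hB₃
  have hregF : RegPr i.1.1 i.1.2.1 i.1.2.2 ((i.1.1.L : ℝ) ^ 3 * B₃ * ε₁) U₀ := by rw [hFL']; exact hreg
  have hloF : (i.1.1.L : ℝ) ^ 3 * B₃ * ε₁ ≤ ε₄ := by rw [hFL']; exact hlo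
  -- the letters' bounds at this admissible background
  have h𝒢 := norm_G i _ U₀ hreg hαe
  have hW := prop4 i _ U₀ hreg hαe
  have hH₁ := norm_H₁ i _ U₀ hreg hαe
  have hB := bound20 i ε₁ V U₀ hε₁ hV hreg hclose
  -- (103): the datum `H₁B`
  have hH₁B_lt : ‖H₁f i U₀ (Bf i V U₀)‖ < 2 * ((3 : ℝ) * i.1.1.L) * B₀ * (L : ℝ) ^ 3 * ε₁ :=
    calc ‖H₁f i U₀ (Bf i V U₀)‖ ≤ B₀ * ‖Bf i V U₀‖ := hH₁ (Bf i V U₀)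
      _ < B₀ * (2 * ((3 : ℝ) * i.1.1.L) * ((L : ℝ) ^ 3 * ε₁)) := mul_lt_mul_of_pos_left hB hB₀
      _ = 2 * ((3 : ℝ) * i.1.1.L) * B₀ * (L : ℝ) ^ 3 * ε₁ := by ring
  have hH₁B_le : ‖H₁f i U₀ (Bf i V U₀)‖ ≤ 2 * B₀ * (L : ℝ) ^ 3 * B₃ * ε₁ := by
    have h6 : 2 * ((3 : ℝ) * i.1.1.L) * B₀ * (L : ℝ) ^ 3 * ε₁ ≤ 2 * B₀ * (L : ℝ) ^ 3 * B₃ * ε₁ := by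
      have h3L : (3 : ℝ) * i.1.1.L ≤ B₃ := hdLB₃
      have hc : 0 ≤ 2 * B₀ * (L : ℝ) ^ 3 * ε₁ := by positivity
      calc 2 * ((3 : ℝ) * i.1.1.L) * B₀ * (L : ℝ) ^ 3 * ε₁ = ((3 : ℝ) * i.1.1.L) * (2 * B₀ * (L : ℝ) ^ 3 * ε₁) := by ring
        _ ≤ B₃ * (2 * B₀ * (L : ℝ) ^ 3 * ε₁) := mul_le_mul_of_nonneg_right h3L hc
        _ = 2 * B₀ * (L : ℝ) ^ 3 * B₃ * ε₁ := by ring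
    exact hH₁B_lt.le.trans h6
  -- PROPOSITION 6 at the T³ objects (PROVED): the solution `A₁` in the (115)-ball `2B₀L³B₃ε₁`
  obtain ⟨A₁, _hA₁ε, hsol, hA₁3, -⟩ := prop6_T3 (n := i.1.2.1) (e i) (he i) (C₁ := (L : ℝ) ^ 3) (ε₄ := 2 * B₀ * (L : ℝ) ^ 3 * B₃ * ε₁) U₀
    (𝒢 := 𝒢f i U₀) (W := Wf i U₀) h𝒢 hW hB₀ hC₄ hL3 hB₃0 hε₁ hdLB₃ le_rfl h2 h3 hreg (𝔄 := H₁f i U₀ (Bf i V U₀)) hH₁B_lt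
  -- CHART-112 (displayed): the exponent `X`
  have hA₁r : ‖A₁‖ < r := by
    have : 3 * B₀ * (L : ℝ) ^ 3 * B₃ * ε₁ ≤ r := by linarith [hε₄a.trans ha5]
    exact hA₁3.trans_le this
  obtain ⟨X, hXh, hXM, h20, h21, hEL⟩ := hChart i ε₁ V U₀ hε₁ hV hreg hclose hαe A₁ hA₁r hsol
  have hX5 : nMax19 i.1.1 i.1.2.1 i.1.2.2 U₀ X < 5 * M * B₀ * (L : ℝ) ^ 3 * B₃ * ε₁ := by
    have hsum : ‖A₁‖ + ‖H₁f i U₀ (Bf i V U₀)‖ < 5 * B₀ * (L : ℝ) ^ 3 * B₃ * ε₁ := by linarith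
    calc nMax19 i.1.1 i.1.2.1 i.1.2.2 U₀ X ≤ M * (‖A₁‖ + ‖H₁f i U₀ (Bf i V U₀)‖) := hXM
      _ < M * (5 * B₀ * (L : ℝ) ^ 3 * B₃ * ε₁) := mul_lt_mul_of_pos_left hsum hM
      _ = 5 * M * B₀ * (L : ℝ) ^ 3 * B₃ * ε₁ := by ring
  have h52 : 5 * M * B₀ * (L : ℝ) ^ 3 * B₃ * ε₁ ≤ 2 * B₀' * (L : ℝ) ^ 3 * B₃ * ε₁ := by
    have h' : (5 * M * B₀) * ((L : ℝ) ^ 3 * B₃ * ε₁) ≤ (2 * B₀') * ((L : ℝ) ^ 3 * B₃ * ε₁) := mul_le_mul_of_nonneg_right (by linarith) hP0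
    linarith
  have h23 : 2 * B₀' * (L : ℝ) ^ 3 * B₃ * ε₁ ≤ 3 * B₀' * (L : ℝ) ^ 3 * B₃ * ε₁ := by
    have h' : (2 * B₀') * ((L : ℝ) ^ 3 * B₃ * ε₁) ≤ (3 * B₀') * ((L : ℝ) ^ 3 * B₃ * ε₁) := mul_le_mul_of_nonneg_right (by linarith) hP0
    linarith
  have hX2 : nMax19 i.1.1 i.1.2.1 i.1.2.2 U₀ X < 2 * B₀' * (L : ℝ) ^ 3 * B₃ * ε₁ := hX5.trans_le h52
  have hX3 : nMax19 i.1.1 i.1.2.1 i.1.2.2 U₀ X < 3 * B₀' * (L : ℝ) ^ 3 * B₃ * ε₁ := hX2.trans_le h23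
  have hXε : nMax19 i.1.1 i.1.2.1 i.1.2.2 U₀ X < ε₄ := hX2.trans_le h2B
  refine ⟨X, hX3, hXh, h20, h21, ?_⟩
  -- the axial representative `W = (e^{iX}U₀)^u ∈ 𝔅_k(V)` from (20)
  have hexp : ∀ b : PBond (i.1.1.P i.1.2.2) 0,
      ((expHermField X b : Matrix.specialUnitaryGroup (Fin 2) ℂ) : Matrix (Fin 2) (Fin 2) ℂ) = NormedSpace.exp (Complex.I • X b) := fun b => by
    rw [expHermField_apply, coe_expHerm (hXh b)]
  obtain ⟨u, hu, hax, hWfib⟩ := h20 (expHermField X) hexp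
  -- GROWTH (★w4's `growth142_T3`, its (γ)-input displayed as `hGrowth`)
  have hκ : 0 ≤ ((1 / 2 - θ) / CP - 96 * (178 * ε₄)) * (((i.1.1.L : ℝ) ^ (i.1.2.2 - i.1.2.1)) ^ 2)⁻¹
      - cS * ε₄ * (((i.1.1.L : ℝ) ^ (i.1.2.2 - i.1.2.1)) ^ 2)⁻¹ := by
    have hη2 : 0 ≤ (((i.1.1.L : ℝ) ^ (i.1.2.2 - i.1.2.1)) ^ 2)⁻¹ := by positivity
    have hsmall : (17088 + cS) * ε₄ ≤ (1 / 2 - θ) / CP := by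
      have h' : ε₄ ≤ (1 / 2 - θ) / (CP * (17088 + cS)) := hε₄a.trans ha6
      rw [le_div_iff₀ (by positivity)] at h'
      rw [le_div_iff₀ hCP]
      linarith
    have key : ∀ η2 : ℝ, 0 ≤ η2 → 0 ≤ ((1 / 2 - θ) / CP - 96 * (178 * ε₄)) * η2 - cS * ε₄ * η2 := by
      intro η2 hη
      have hrw : ((1 / 2 - θ) / CP - 96 * (178 * ε₄)) * η2 - cS * ε₄ * η2 = ((1 / 2 - θ) / CP - (17088 + cS) * ε₄) * η2 := by ring
      rw [hrw]
      exact mul_nonneg (by linarith) hη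
    exact key _ hη2
  exact growth142_T3 i.1.1 i.2.2 hε₄4 hloF V U₀ hregF X hXh hXε u _ rfl hWfib hCP hθ.le hκ
    (hGrowth i ε₁ ε₄ V U₀ X u _ hε₁ hε₄4 hlo hV hreg hclose hXh hXε h20 h21 hu rfl hax hWfib (hEL u hu hWfib))

end Summit.QuantumFields.YangMills.Theorems.Prop7CminOfP6T3Pd

end
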